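import Summits.AnomalousDissipation.AnomalousDissipation.Theorems.SolenoidalFractalHomogenisationLagrangianStepVmodCoarseLoss
import Literature.Analysis.FunctionSpaces.TorusFourierModes
import HarnessLib

/-!
# K1L_D (stmt-AnomalousDissipation-27980), (V_mod) flat stage (ℓ2): SLOW-TEST TOOLS — the modewise adjoint coarse loss, the slow solenoidal class as
# the class of its Fourier truncation, and the Leray reductions on the test side (prover ad-k1loc-p3 g10; `--supports 27980 --as helper`)

Three elementary facts used by the short-window (generator) rows of the flat blocks (certifier table
`Cruxes/LagrangianRenormalisationStep/Lines/onelevel-ss-regimes.md` §0 «loss facts», §1 (R-a), §4):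
* `lossAdj_ge_sum_modes` — **modewise adjoint coarse loss**: for the carrier-free propagator `T` with tensor `NearIso 𝔹 lo′ hi′` (`0 < lo′`) and a weakly
  divergence-free `ζ`, `Σ_{k ∈ S} (1 − e^{−8π² lo′ |k|² (t−s)}) ‖ζ̂(k)‖² ≤ q*_T(ζ) = lossAdj (T s t) ζ` for EVERY finite `S` (adjoint = reversed carrier-free
  propagator `IsPropagator.adjoint_eq`, modewise decay `norm_sq_fcoeff_carrierFree_decay`, Parseval) — the weighted form of `lossAdj_ge_of_supp`;
* `toLp_fourierTruncate_eq_of_isSlow` — a SLOW class `ζ` (no modes outside `freqBall (n/4)`) IS the `L²` class of the smooth trigonometric polynomial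
  `Torus.fourierTruncate (n/4) ⇑ζ` (same Fourier coefficients, Parseval); with `isSlow_starProjection` (the Leray projection shrinks supports) the slow
  solenoidal test of a block is a smooth divergence-free band-limited field, as `PassiveVectorTensorPropagatorTestIdentity` / `…VmodGeneratorPairing` want;
* `inner_propagator_sub_eq_inner_starProjection`, `lossAdj_starProjection_le` — on the TEST side both members see only `P_σ ζ`, and `q*_T(P_σ ζ) ≤ q*_T(ζ)`.
NOT a proof of any block, of `stub_Vmod_of_VRH`, of K1L_D or of AD; rung F-D1.A0.
-/

set_option linter.dupNamespace false

noncomputable section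

namespace Summit.AnomalousDissipation.AnomalousDissipation.Theorems.SolenoidalFractalHomogenisation.LagrangianStep.VmodFlat

open Literature.Analysis Literature.Analysis.FluidPDE Literature.Analysis.FunctionSpaces
open MeasureTheory Set Filter UnitAddTorus
open scoped ENNReal NNReal InnerProductSpace
open Summit.AnomalousDissipation.AnomalousDissipation.Theorems.SolenoidalFractalHomogenisation.LagrangianStep.CellClauseMod

/-! ## §1 The modewise adjoint coarse loss -/

/-- Modewise decay for a propagator whose carrier vanishes identically (any carrier term equal to `0`, e.g. the reversed carrier of the
adjoint). [folklore] -/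
theorem norm_sq_fcoeff_decay_of_carrier_zero {T₀ : ℝ} {𝔹 : Torus.Visc4 (Fin 3)} {lo' hi' : ℝ} (h𝔹 : Torus.NearIso 𝔹 lo' hi') (hlo' : 0 < lo')
    {b : ℝ → VF} (hb : ∀ r y, b r y = 0) {U : ℝ → ℝ → (V2 →L[ℝ] V2)} (hU : Torus.IsPropagator T₀ b 𝔹 U)
    {s t : ℝ} (hs : 0 ≤ s) (hst : s ≤ t) (htT : t ≤ T₀) (hsT : s < T₀) (x : V2) (hx : Torus.IsWeaklyDivFree (x : VF)) (k : Fin 3 → ℤ) :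
    ‖fc (U s t x) k‖ ^ 2 ≤ Real.exp (-(8 * Real.pi ^ 2 * lo' * Torus.freqNormSq k * (t - s))) * ‖fc x k‖ ^ 2 := by
  obtain rfl : b = fun (_ : ℝ) (_ : UnitAddTorus (Fin 3)) => (0 : EuclideanSpace ℝ (Fin 3)) := funext fun r => funext fun y => hb r y
  exact norm_sq_fcoeff_carrierFree_decay h𝔹 hlo' hU hs hst htT hsT x hx k

/-- **MODEWISE ADJOINT COARSE LOSS**: for the carrier-free propagator `T` (tensor `NearIso 𝔹 lo′ hi′`, `0 < lo′`), a weakly divergence-free `ζ` and every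
finite set of frequencies `S`:  `Σ_{k∈S} (1 − exp(−8π² lo′ |k|² (t−s)))·‖ζ̂(k)‖² ≤ lossAdj (T s t) ζ`. -/
theorem lossAdj_ge_sum_modes {T₀ : ℝ} {𝔹 : Torus.Visc4 (Fin 3)} {lo' hi' : ℝ} (h𝔹 : Torus.NearIso 𝔹 lo' hi') (hlo' : 0 < lo')
    {T : ℝ → ℝ → (V2 →L[ℝ] V2)}
    (hT : Torus.IsPropagator T₀ (fun (_ : ℝ) (_ : UnitAddTorus (Fin 3)) => (0 : EuclideanSpace ℝ (Fin 3))) 𝔹 T)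
    {s t : ℝ} (hs : 0 ≤ s) (hst : s ≤ t) (htT : t ≤ T₀) (ζ : V2) (hζ : Torus.IsWeaklyDivFree (ζ : VF)) (S : Finset (Fin 3 → ℤ)) :
    ∑ k ∈ S, (1 - Real.exp (-(8 * Real.pi ^ 2 * lo' * Torus.freqNormSq k * (t - s)))) * ‖fc ζ k‖ ^ 2 ≤ lossAdj (T s t) ζ := by
  unfold lossAdj
  rcases hst.eq_or_lt with hEq | hLt
  · subst hEq
    have h0 : ∀ k : Fin 3 → ℤ, (1 - Real.exp (-(8 * Real.pi ^ 2 * lo' * Torus.freqNormSq k * (s - s)))) * ‖fc ζ k‖ ^ 2 = 0 := fun k => by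
      rw [sub_self, mul_zero, neg_zero, Real.exp_zero, sub_self, zero_mul]
    rw [Finset.sum_eq_zero fun k _ => h0 k]
    exact LossCurrency.lossAdj_nonneg (hT.norm_le s s) ζ
  · have hb : MemLp (Torus.stLift (fun (_ : ℝ) (_ : UnitAddTorus (Fin 3)) => (0 : EuclideanSpace ℝ (Fin 3)))) ∞
        (volume.restrict (Ioo 0 T₀ ×ˢ (univ : Set (EuclideanSpace ℝ (Fin 3))))) := memLp_top_const 0
    have hbdiv : ∀ᵐ τ ∂(volume.restrict (Ioo (0:ℝ) T₀)),
        Torus.IsWeaklyDivFree ((fun (_ : ℝ) (_ : UnitAddTorus (Fin 3)) => (0 : EuclideanSpace ℝ (Fin 3))) τ) :=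
      ae_of_all _ fun τ θ hθ => by simp
    rw [hT.adjoint_eq h𝔹 hlo' hb hbdiv hs hLt htT]
    have h𝔹' := (Torus.nearIso_majorTranspose_iff 𝔹 lo' hi').2 h𝔹
    have hV := Torus.isPropagator_propagator h𝔹' hlo'
      (Torus.memLp_top_stLift_reversed_window hb hs htT) (Torus.ae_isWeaklyDivFree_reversed_window hbdiv hs htT)
    set V := Torus.propagator h𝔹' hlo' (Torus.memLp_top_stLift_reversed_window hb hs htT)
      (Torus.ae_isWeaklyDivFree_reversed_window hbdiv hs htT) with hVdef
    have hts : 0 < t - s := sub_pos.2 hLt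
    -- modewise decay of the reversed (still carrier-free) propagator
    have hmode : ∀ k, ‖fc (V 0 (t - s) ζ) k‖ ^ 2 ≤ Real.exp (-(8 * Real.pi ^ 2 * lo' * Torus.freqNormSq k * (t - s))) * ‖fc ζ k‖ ^ 2 := by
      intro k
      have h := norm_sq_fcoeff_decay_of_carrier_zero h𝔹' hlo' (fun r y => by simp) hV le_rfl hts.le le_rfl hts ζ hζ k
      rwa [sub_zero] at h
    -- Parseval on both sides
    have h1 := hasSum_norm_sq_fcoeff (V 0 (t - s) ζ)
    have h2 := hasSum_norm_sq_fcoeff ζ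
    have hdiff : HasSum (fun k => ‖fc ζ k‖ ^ 2 - ‖fc (V 0 (t - s) ζ) k‖ ^ 2) (‖ζ‖ ^ 2 - ‖V 0 (t - s) ζ‖ ^ 2) := h2.sub h1
    have hnn : ∀ k, 0 ≤ ‖fc ζ k‖ ^ 2 - ‖fc (V 0 (t - s) ζ) k‖ ^ 2 := by
      intro k
      have hE1 : Real.exp (-(8 * Real.pi ^ 2 * lo' * Torus.freqNormSq k * (t - s))) ≤ 1 := by
        apply Real.exp_le_one_iff.2
        have := Real.pi_pos; have := Torus.freqNormSq_nonneg k
        have : 0 ≤ 8 * Real.pi ^ 2 * lo' * Torus.freqNormSq k * (t - s) := by positivity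
        linarith
      have := hmode k
      nlinarith [sq_nonneg ‖fc ζ k‖]
    calc ∑ k ∈ S, (1 - Real.exp (-(8 * Real.pi ^ 2 * lo' * Torus.freqNormSq k * (t - s)))) * ‖fc ζ k‖ ^ 2
        ≤ ∑ k ∈ S, (‖fc ζ k‖ ^ 2 - ‖fc (V 0 (t - s) ζ) k‖ ^ 2) := Finset.sum_le_sum fun k _ => by nlinarith [hmode k]
      _ ≤ ‖ζ‖ ^ 2 - ‖V 0 (t - s) ζ‖ ^ 2 := sum_le_hasSum S (fun k _ => hnn k) hdiff

/-! ## §2 A slow class is the class of its truncation; the Leray projection keeps slowness -/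

/-- Two `L²` classes with the same Fourier coefficients are equal (Parseval). [folklore] -/
theorem eq_of_fc_eq {x y : V2} (h : ∀ k, fc x k = fc y k) : x = y := by
  have hP := hasSum_norm_sq_fcoeff (x - y)
  have h0 : (fun k : Fin 3 → ℤ => ‖mFourierCoeff (EuclideanSpace.complexify ∘ ⇑(x - y)) k‖ ^ 2) = fun _ => 0 := by
    funext k
    have : fc (x - y) k = 0 := by rw [fc_sub, h k, sub_self]
    rw [show mFourierCoeff (EuclideanSpace.complexify ∘ ⇑(x - y)) k = fc (x - y) k from rfl, this, norm_zero]
    ring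
  rw [h0] at hP
  have hxy : ‖x - y‖ ^ 2 = 0 := hP.unique hasSum_zero
  rwa [sq_eq_zero_iff, norm_eq_zero, sub_eq_zero] at hxy

/-- The Fourier coefficients of the class of the truncation are those of the truncation: on the ball those of `ζ`, off the ball `0`. [folklore] -/
theorem fc_toLp_fourierTruncate (N : ℕ) (ζ : V2) (k : Fin 3 → ℤ) :
    fc (((Torus.isSmooth_fourierTruncate N (ζ : VF)).memLp 2).toLp (Torus.fourierTruncate N (ζ : VF))) k
      = if k ∈ Torus.freqBall N then fc ζ k else 0 := by
  have hae := ((Torus.isSmooth_fourierTruncate N (ζ : VF)).memLp 2).coeFn_toLp (μ := volume)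
  rw [fc, Torus.mFourierCoeff_congr_ae (hae.fun_comp EuclideanSpace.complexify) k,
    Torus.mFourierCoeff_fourierTruncate ((Lp.memLp ζ).integrable one_le_two) N k]
  rfl

/-- **A slow class is the class of its truncation**: `IsSlow n ζ` ⇒ `toLp (fourierTruncate (n/4) ⇑ζ) = ζ`. -/
theorem toLp_fourierTruncate_eq_of_isSlow {n : ℕ} (ζ : V2) (hζ : IsSlow n ζ) :
    ((Torus.isSmooth_fourierTruncate (n / 4) (ζ : VF)).memLp 2).toLp (Torus.fourierTruncate (n / 4) (ζ : VF)) = ζ := by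
  refine eq_of_fc_eq fun k => ?_
  rw [fc_toLp_fourierTruncate]
  split_ifs with hk
  · rfl
  · exact (hζ k hk).symm

/-- The Leray projection shrinks Fourier supports, so it keeps slowness. -/
theorem isSlow_starProjection {n : ℕ} {ζ : V2} (hζ : IsSlow n ζ) : IsSlow n ((Torus.divFreeL2 (Fin 3)).starProjection ζ) := by
  intro k hk
  have h := Torus.norm_mFourierCoeff_starProjection_le ζ k
  have h0 : ‖fc ((Torus.divFreeL2 (Fin 3)).starProjection ζ) k‖ ≤ 0 := by
    calc ‖fc ((Torus.divFreeL2 (Fin 3)).starProjection ζ) k‖ ≤ ‖fc ζ k‖ := h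
      _ = 0 := by rw [hζ k hk, norm_zero]
  exact norm_le_zero_iff.1 h0

/-- The Leray projection shrinks Fourier supports, so it keeps fastness. -/
theorem isFast_starProjection {n : ℕ} {x : V2} (hx : IsFast n x) : IsFast n ((Torus.divFreeL2 (Fin 3)).starProjection x) := by
  intro k hk
  have h := Torus.norm_mFourierCoeff_starProjection_le x k
  have h0 : ‖fc ((Torus.divFreeL2 (Fin 3)).starProjection x) k‖ ≤ 0 := by
    calc ‖fc ((Torus.divFreeL2 (Fin 3)).starProjection x) k‖ ≤ ‖fc x k‖ := h
      _ = 0 := by rw [hx k hk, norm_zero]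
  exact norm_le_zero_iff.1 h0

/-! ## §3 The Leray reductions on the test side -/

/-- Both members of a block map into solenoidal classes, so a test is seen only through its Leray projection:
`⟪U s t x − T s t x, ζ⟫ = ⟪U s t x − T s t x, P_σ ζ⟫`. -/
theorem inner_propagator_sub_eq_inner_starProjection {TU TT : ℝ} {bU bT : ℝ → VF} {𝔹U 𝔹T : Torus.Visc4 (Fin 3)}
    {U T : ℝ → ℝ → (V2 →L[ℝ] V2)} (hU : Torus.IsPropagator TU bU 𝔹U U) (hT : Torus.IsPropagator TT bT 𝔹T T) (s t : ℝ) (x ζ : V2) :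
    ⟪U s t x - T s t x, ζ⟫_ℝ = ⟪U s t x - T s t x, (Torus.divFreeL2 (Fin 3)).starProjection ζ⟫_ℝ := by
  have hmem : U s t x - T s t x ∈ Torus.divFreeL2 (Fin 3) :=
    (Torus.divFreeL2 (Fin 3)).sub_mem ((Torus.mem_divFreeL2_iff _).2 (hU.divFree s t x)) ((Torus.mem_divFreeL2_iff _).2 (hT.divFree s t x))
  have h0 : ⟪ζ - (Torus.divFreeL2 (Fin 3)).starProjection ζ, U s t x - T s t x⟫_ℝ = 0 :=
    (Torus.divFreeL2 (Fin 3)).starProjection_inner_eq_zero ζ _ hmem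
  rw [inner_sub_left, sub_eq_zero] at h0
  rw [real_inner_comm, h0, real_inner_comm]

/-- The adjoint of a propagator window map sees a test only through its Leray projection: `(T s t)† ζ = (T s t)† (P_σ ζ)`. -/
theorem adjoint_apply_eq_adjoint_starProjection {TT : ℝ} {bT : ℝ → VF} {𝔹T : Torus.Visc4 (Fin 3)} {T : ℝ → ℝ → (V2 →L[ℝ] V2)}
    (hT : Torus.IsPropagator TT bT 𝔹T T) (s t : ℝ) (ζ : V2) :
    ContinuousLinearMap.adjoint (T s t) ζ = ContinuousLinearMap.adjoint (T s t) ((Torus.divFreeL2 (Fin 3)).starProjection ζ) := by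
  refine ext_inner_right ℝ fun y => ?_
  rw [ContinuousLinearMap.adjoint_inner_left, ContinuousLinearMap.adjoint_inner_left]
  have hmem : T s t y ∈ Torus.divFreeL2 (Fin 3) := (Torus.mem_divFreeL2_iff _).2 (hT.divFree s t y)
  have h0 : ⟪ζ - (Torus.divFreeL2 (Fin 3)).starProjection ζ, T s t y⟫_ℝ = 0 :=
    (Torus.divFreeL2 (Fin 3)).starProjection_inner_eq_zero ζ _ hmem
  rw [inner_sub_left, sub_eq_zero] at h0
  exact h0

/-- **The adjoint loss of the Leray projection of a test is at most that of the test**: `q*_T(P_σ ζ) ≤ q*_T(ζ)`. -/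
theorem lossAdj_starProjection_le {TT : ℝ} {bT : ℝ → VF} {𝔹T : Torus.Visc4 (Fin 3)} {T : ℝ → ℝ → (V2 →L[ℝ] V2)}
    (hT : Torus.IsPropagator TT bT 𝔹T T) (s t : ℝ) (ζ : V2) :
    lossAdj (T s t) ((Torus.divFreeL2 (Fin 3)).starProjection ζ) ≤ lossAdj (T s t) ζ := by
  unfold lossAdj
  rw [← adjoint_apply_eq_adjoint_starProjection hT s t ζ]
  have h := (Torus.divFreeL2 (Fin 3)).norm_starProjection_apply_le ζ
  nlinarith [norm_nonneg ((Torus.divFreeL2 (Fin 3)).starProjection ζ)]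

/-- **The forward loss of the Leray projection of a datum is at most that of the datum**: `q_T(P_σ x) ≤ q_T(x)`. -/
theorem lossFwd_starProjection_le {TT : ℝ} {bT : ℝ → VF} {𝔹T : Torus.Visc4 (Fin 3)} {T : ℝ → ℝ → (V2 →L[ℝ] V2)}
    (hT : Torus.IsPropagator TT bT 𝔹T T) (s t : ℝ) (x : V2) :
    lossFwd (T s t) ((Torus.divFreeL2 (Fin 3)).starProjection x) ≤ lossFwd (T s t) x := by
  unfold lossFwd
  rw [← hT.apply_eq_apply_starProjection s t x]
  have h := (Torus.divFreeL2 (Fin 3)).norm_starProjection_apply_le x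
  nlinarith [norm_nonneg ((Torus.divFreeL2 (Fin 3)).starProjection x)]

end Summit.AnomalousDissipation.AnomalousDissipation.Theorems.SolenoidalFractalHomogenisation.LagrangianStep.VmodFlat

end
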